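import Mathlib.Analysis.SpecialFunctions.JapaneseBracket
import Literature.Analysis.FluidPDE.PineauVicolRSSChaeWolf
import Literature.Analysis.FluidPDE.LeraySelfSimilarCalculus
import Literature.Analysis.FluidPDE.TsaiSelfSimilarHolds
import HarnessLib

/-!
# Pineau–Vicol 2026, Theorem 1.4 — proofs, II: the non-rotated slice `α = 0` (Tsai 1998)

Analysis/FluidPDE proof file (theorems only; no definitions, no named facts), companion of
`PineauVicolRSS.lean` / `PineauVicolRSSChaeWolf.lean` (and of the first-steps file
`PineauVicolRSSProofs.lean`). It proves, unconditionally, the `α = 0`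
instance of the rendering `pineauVicol2026_rss_liouville` of B. Pineau, V. Vicol,
arXiv:2607.09619 (2026), Theorem 1.4 — i.e. Conjecture 1.1 / Remark 1.2 at `α = 0`, which the
paper recalls as known (p. 2: "Leray's question … was answered in the negative by Nečas, Růžička,
and Šverák [50] … Tsai [60] established the same conclusion for profiles `U ∈ Lᵖ(ℝ³)` with
`p ∈ (3, ∞]`"; p. 4: "When `α = 0`, the Liouville theorem established in [60] …"):

* `pineauVicol2026_rss_liouville_alpha_zero`: if `(u, p)` is a classical Navier–Stokes solution
  (`ν = 1`, `f = 0`) on `[−1, 0)` with a Type I bound `‖u(t,x)‖ ≤ C₀/(‖x‖ + √(−t))` and `u` is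
  Leray self-similar there, `u(x,t) = (−t)^{-1/2} U(x/√(−t))` (the ansatz (1.7) with `α = 0`),
  then `U ≡ 0`.

Proof (the paper's p. 4 discussion, formalised over the tree): the ansatz field is Leray's
`lerayBackward ½ 0 U` (`pvAnsatz_zero_eq_lerayBackward`); it extends to a classical solution on
`(−∞, 0)` (`exists_isClassicalNSSolutionOn_Iio_of_rss`); by scale covariance the normalised
pressure is itself self-similar (`normalisedPressure_selfSimilar`), hence of Leray's form
`(−t)⁻¹ Q(x/√(−t))` with `Q = p(−1, ·) − p(−1, 0)`; Leray's reduction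
(`lerayBackward_isClassical_iff_holds`) makes `(U, Q)` a profile (`IsLerayProfile 1 ½ U Q`); the
Type I bound gives `|U(y)| ≤ C₀/(1 + |y|)`, so `U ∈ L⁴(ℝ³)` (`memLp_four_of_profile_bound`, from
Mathlib's `integrable_one_add_norm`), and Tsai 1998, Theorem 1 (`tsai_selfsimilar_holds`, proved in
the tree) gives `U = 0`.

## References

* B. Pineau, V. Vicol, arXiv:2607.09619 (2026), §1.1–1.2, Remark 1.2, Theorem 1.4. [PineauVicol2026]
* T.-P. Tsai, Arch. Rational Mech. Anal. 143 (1998) 29–51, Theorem 1. [Tsai1998]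
* J. Nečas, M. Růžička, V. Šverák, Acta Math. 176 (1996) 283–294, Theorem 1. [NecasRuzickaSverak1996]
-/

noncomputable section

open Set Filter Function MeasureTheory
open scoped Topology ContDiff ENNReal

namespace Literature.Analysis.FluidPDE


/-- The RSS ansatz (1.7) with `α = 0` is Leray's backward self-similar ansatz (1.2) with rate
`a = ½` and blow-up time `T = 0`: `(−t)^{-1/2} U(x/√(−t))` (Pineau–Vicol 2026, §1.2: "When
`α = 0`, (1.7) reduces to the self-similar ansatz (1.2) because `R(0) = Id`"). [cite: PineauVicol2026, §1.2 after (1.7) (arXiv:2607.09619 p. 3)] -/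
theorem pvAnsatz_zero_eq_lerayBackward
    (U : EuclideanSpace ℝ (Fin 3) → EuclideanSpace ℝ (Fin 3)) :
    pvAnsatz 0 (fun y _ => U y) = lerayBackward (1 / 2) 0 U := by
  funext t x
  have h : (2 : ℝ) * (1 / 2) * (0 - t) = -t := by ring
  simp only [pvAnsatz, lerayBackward_apply, zero_mul, neg_zero, rotZ_zero, h]

section Pressure

variable {E : Type*} [NormedAddCommGroup E] [InnerProductSpace ℝ E] [FiniteDimensional ℝ E]

/-- Normalising the pressure (`p ↦ p − p(·,0)`) preserves classical solutions. [folklore] -/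
private theorem isClassicalNSSolutionOn_normalise {S : Set ℝ} {ν : ℝ} {f u : ℝ → E → E}
    {p : ℝ → E → ℝ} (h : IsClassicalNSSolutionOn S ν f u p) :
    IsClassicalNSSolutionOn S ν f u (fun t x => p t x - p t 0) where
  smooth_velocity := h.smooth_velocity
  smooth_pressure := h.smooth_pressure.sub_apply_zero
  momentum t ht x := by
    rw [gradient_sub_const]
    exact h.momentum t ht x
  divFree := h.divFree

/-- Replacing the pressure by a field with the same slices on `S` preserves classical
solutions. [folklore] -/
private theorem isClassicalNSSolutionOn_congr_pressure {S : Set ℝ} {ν : ℝ}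
    {f u : ℝ → E → E} {p p' : ℝ → E → ℝ} (h : IsClassicalNSSolutionOn S ν f u p)
    (hp : ∀ t ∈ S, p' t = p t) :
    IsClassicalNSSolutionOn S ν f u p' where
  smooth_velocity := h.smooth_velocity
  smooth_pressure := by
    refine h.smooth_pressure.congr fun z hz => ?_
    obtain ⟨t, x⟩ := z
    simp only [uncurry_apply_pair, hp t hz.1]
  momentum t ht x := by
    rw [hp t ht]
    exact h.momentum t ht x
  divFree := h.divFree

/-- **The normalised pressure of a self-similar classical solution is self-similar.** If `v` is
invariant under every Leray rescaling `c v(c²t, cx) = v(t,x)`, `c > 0`, and `(v, P)` is an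
unforced classical solution on `(−∞, 0)`, then `c² (P(c²t, cx) − P(c²t, 0)) = P(t,x) − P(t,0)`
for `c > 0`, `t < 0`: both `(v, P − P(·,0))` and its rescaling solve the equations with the SAME
velocity, so their pressure gradients agree (`pressure_sub_apply_zero_eq_of_eventuallyEq`).
(Tsai 1998, p. 46: "we can define `p` by (1.2)₂"; Pineau–Vicol 2026, §2: `P = RᵢRⱼ(UᵢUⱼ)` up to a
constant.) [folklore] -/
theorem normalisedPressure_selfSimilar {ν : ℝ} {v : ℝ → E → E} {P : ℝ → E → ℝ}
    (hv : IsClassicalNSSolutionOn (Iio 0) ν 0 v P) (hss : ∀ c : ℝ, 0 < c → nsRescale c v = v)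
    {c : ℝ} (hc : 0 < c) {t : ℝ} (ht : t < 0) (x : E) :
    c ^ 2 * (P (c ^ 2 * t) (c • x) - P (c ^ 2 * t) 0) = P t x - P t 0 := by
  have h0 := isClassicalNSSolutionOn_normalise hv
  have h1 := IsClassicalNSSolutionOn.nsRescale_holds h0 hc
  have hS : (fun t : ℝ => c ^ 2 * t) ⁻¹' Iio (0 : ℝ) = Iio 0 := by
    ext s
    simp only [mem_preimage, mem_Iio]
    constructor
    · intro h
      by_contra hs
      have : 0 ≤ c ^ 2 * s := mul_nonneg (sq_nonneg c) (not_lt.1 hs)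
      linarith
    · exact fun h => mul_neg_of_pos_of_neg (by positivity) h
  rw [nsRescaleForce_zero, hss c hc, hS] at h1
  have h2 := h1.pressure_sub_apply_zero_eq_of_eventuallyEq h0 (Iio_mem_nhds ht) (Iio_mem_nhds ht)
    (Eventually.of_forall fun _ => rfl) x
  simp only [nsRescalePressure_apply, smul_zero, sub_self, mul_zero, sub_zero] at h2
  exact h2

end Pressure

/-- A continuous profile with the scale-critical bound (1.9), `|U(y)| ≤ C₀/(|y| + 1)`, lies in
`L⁴(ℝ³)` (indeed in every `L^q`, `q > 3`; Pineau–Vicol 2026, p. 4: "(1.9) … guarantees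
`U ∈ Lᵖ(ℝ³)` for every `p > 3`"): `(1 + |y|)^{-4}` is integrable on `ℝ³`
(Mathlib `integrable_one_add_norm`). [cite: PineauVicol2026, §1.2 (arXiv:2607.09619 p. 4)] -/
theorem memLp_four_of_profile_bound {C₀ : ℝ}
    {U : EuclideanSpace ℝ (Fin 3) → EuclideanSpace ℝ (Fin 3)} (hU : Continuous U)
    (hb : ∀ y : EuclideanSpace ℝ (Fin 3), ‖U y‖ ≤ C₀ / (‖y‖ + 1)) :
    MemLp U 4 volume := by
  have hmeasU : AEStronglyMeasurable U volume := hU.aestronglyMeasurable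
  have hpos : ∀ y : EuclideanSpace ℝ (Fin 3), 0 < 1 + ‖y‖ := fun y => by positivity
  have hcont : Continuous fun y : EuclideanSpace ℝ (Fin 3) => (1 + ‖y‖) ^ (-1 : ℝ) :=
    (continuous_const.add continuous_norm).rpow_const fun y => Or.inl (hpos y).ne'
  have hint :
      Integrable (fun y : EuclideanSpace ℝ (Fin 3) => (1 + ‖y‖) ^ (-(4 : ℝ))) volume :=
    integrable_one_add_norm (by rw [finrank_euclideanSpace_fin]; norm_num)
  have hg1 : MemLp (fun y : EuclideanSpace ℝ (Fin 3) => (1 + ‖y‖) ^ (-1 : ℝ)) 4 volume := by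
    refine (integrable_norm_rpow_iff hcont.aestronglyMeasurable (by norm_num) (by simp)).1 ?_
    refine hint.congr (ae_of_all _ fun y => ?_)
    have h0 : 0 ≤ (1 + ‖y‖) ^ (-1 : ℝ) := Real.rpow_nonneg (hpos y).le _
    simp only [Real.norm_of_nonneg h0, ENNReal.toReal_ofNat]
    rw [← Real.rpow_mul (hpos y).le]
    norm_num
  have hg : MemLp (fun y : EuclideanSpace ℝ (Fin 3) => |C₀| * (1 + ‖y‖) ^ (-1 : ℝ)) 4 volume :=
    hg1.const_mul _
  refine hg.of_le hmeasU (ae_of_all _ fun y => ?_)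
  have h0 : 0 ≤ (1 + ‖y‖) ^ (-1 : ℝ) := Real.rpow_nonneg (hpos y).le _
  rw [Real.norm_of_nonneg (mul_nonneg (abs_nonneg _) h0), Real.rpow_neg_one, ← div_eq_mul_inv,
    add_comm]
  exact (hb y).trans (div_le_div_of_nonneg_right (le_abs_self C₀) (by positivity))

/-- **Pineau–Vicol 2026, Theorem 1.4 at `α = 0` (= Tsai 1998, Theorem 1, for Type I self-similar
classical solutions; the `SS` rung of the hierarchy `SS ⊆ RSS ⊆ DSS ⊆ RDSS`).** If `(u, p)` is a
classical Navier–Stokes solution (`ν = 1`, `f = 0`) on `[−1, 0)` obeying the Type I bound (1.10),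
`‖u(t,x)‖ ≤ C₀/(‖x‖ + √(−t))`, and `u` is Leray self-similar there,
`u(x,t) = (−t)^{-1/2} U(x/√(−t))` (the ansatz (1.7) with `α = 0`), then `U ≡ 0` — for every real
`C₀`, with no threshold and no extra regularity of `U`. Unconditional (trust base: Mathlib's
axioms, through `tsai_selfsimilar_holds`). [cite: PineauVicol2026, Theorem 1.4, case α = 0 (arXiv:2607.09619 p. 4); Tsai1998 Thm 1] -/
theorem pineauVicol2026_rss_liouville_alpha_zero (C₀ : ℝ)
    (u : ℝ → EuclideanSpace ℝ (Fin 3) → EuclideanSpace ℝ (Fin 3))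
    (p : ℝ → EuclideanSpace ℝ (Fin 3) → ℝ)
    (U : EuclideanSpace ℝ (Fin 3) → EuclideanSpace ℝ (Fin 3))
    (hsol : IsClassicalNSSolutionOn (Ico (-1) 0) 1 0 u p)
    (hI : ∀ t ∈ Ico (-1 : ℝ) 0, ∀ x : EuclideanSpace ℝ (Fin 3),
      ‖u t x‖ ≤ C₀ / (‖x‖ + Real.sqrt (-t)))
    (hans : ∀ t ∈ Ico (-1 : ℝ) 0, ∀ x : EuclideanSpace ℝ (Fin 3),
      u t x = pvAnsatz 0 (fun y _ => U y) t x) :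
    U = 0 := by
  have hmem : (-1 : ℝ) ∈ Ico (-1 : ℝ) 0 := ⟨le_rfl, by norm_num⟩
  -- the ansatz field is 2-DSS (any factor works for `α = 0`) and extends to `(−∞, 0)`
  have hφ : ∀ (θ : ℝ) (w : EuclideanSpace ℝ (Fin 3)),
      rotZ (θ + 0 * (2 * Real.log 2)) w = rotZ θ w := by
    intro θ w
    rw [zero_mul, add_zero]
  have hdss : IsDiscretelySelfSimilar 2 (pvAnsatz 0 (fun y _ => U y)) :=
    isDiscretelySelfSimilar_pvAnsatz two_pos hφ U
  obtain ⟨P, hP⟩ := exists_isClassicalNSSolutionOn_Iio_of_rss hsol one_lt_two hdss hans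
  rw [pvAnsatz_zero_eq_lerayBackward] at hP
  have hss : ∀ c : ℝ, 0 < c →
      nsRescale c (lerayBackward (1 / 2 : ℝ) 0 U) = lerayBackward (1 / 2) 0 U :=
    fun c hc => isSelfSimilar_lerayBackward_zero (1 / 2) U c hc
  -- the normalised pressure is Leray's `(−t)⁻¹ Q(x/√(−t))` with `Q = P(−1,·) − P(−1,0)`
  set Q : EuclideanSpace ℝ (Fin 3) → ℝ := fun y => P (-1) y - P (-1) 0 with hQ
  have hPQ : ∀ t ∈ Iio (0 : ℝ),
      lerayBackwardPressure (1 / 2) 0 Q t = fun x => P t x - P t 0 := by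
    intro t ht
    have ht' : t < 0 := ht
    have hnt : 0 < -t := by linarith
    funext x
    have hc : 0 < (Real.sqrt (-t))⁻¹ := inv_pos.2 (Real.sqrt_pos.2 hnt)
    have key := normalisedPressure_selfSimilar hP hss hc ht' x
    have hsq : ((Real.sqrt (-t))⁻¹) ^ 2 = (-t)⁻¹ := by rw [inv_pow, Real.sq_sqrt hnt.le]
    have hct : ((Real.sqrt (-t))⁻¹) ^ 2 * t = -1 := by
      rw [hsq, inv_mul_eq_div, div_neg, div_self ht'.ne]
    rw [hct, hsq] at key
    have h2 : (2 : ℝ) * (1 / 2) * (0 - t) = -t := by ring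
    simp only [lerayBackwardPressure, h2, hQ]
    exact key
  have hP' : IsClassicalNSSolutionOn (Iio 0) 1 0 (lerayBackward (1 / 2) 0 U)
      (lerayBackwardPressure (1 / 2) 0 Q) :=
    isClassicalNSSolutionOn_congr_pressure (isClassicalNSSolutionOn_normalise hP) hPQ
  -- smoothness of `U = u(−1)` and `Q`
  have hUeq : U = u (-1) := by
    funext y
    rw [hans (-1) hmem y, pvAnsatz_neg_one]
  have hUs : ContDiff ℝ ∞ U := by
    rw [hUeq]
    exact hsol.contDiff_velocity hmem
  have hQs : ContDiff ℝ ∞ Q :=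
    (hP.contDiff_pressure (show (-1 : ℝ) ∈ Iio 0 by norm_num)).sub contDiff_const
  -- Leray's reduction: `(U, Q)` is a profile with `ν = 1`, `a = ½`
  have hL := @lerayBackward_isClassical_iff_holds (EuclideanSpace ℝ (Fin 3)) _ _ _
  have hprof : IsLerayProfile 1 (1 / 2) U Q :=
    (hL (ν := 1) (a := 1 / 2) (T := 0) (by norm_num) hUs hQs).1 hP'
  -- `U ∈ L⁴` from the Type I bound, and Tsai's theorem
  have hLp : MemLp U 4 volume :=
    memLp_four_of_profile_bound hUs.continuous (profile_bound_of_typeI hI hans)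
  have hT := @tsai_selfsimilar_holds
  exact hT (ν := 1) (a := 1 / 2) one_pos (by norm_num) hprof (q := 4) (by norm_num) (by simp) hLp

/-- Consequently the `α = 0` slice of `pineauVicol2026_rss_liouville` holds outright: for every
`C₀ > 0` and any thresholds, the conclusion `U = 0` needs neither `|α| < α₁` nor the `C²`
hypothesis when `α = 0` (bookkeeping restatement in the binder shape of the fact). [cite: PineauVicol2026, Theorem 1.4, case α = 0 (arXiv:2607.09619 p. 4)] -/
theorem pineauVicol2026_rss_liouville_alpha_zero' (C₀ : ℝ)
    (u : ℝ → EuclideanSpace ℝ (Fin 3) → EuclideanSpace ℝ (Fin 3))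
    (p : ℝ → EuclideanSpace ℝ (Fin 3) → ℝ)
    (U : EuclideanSpace ℝ (Fin 3) → EuclideanSpace ℝ (Fin 3))
    (hsol : IsClassicalNSSolutionOn (Ico (-1) 0) 1 0 u p)
    (hI : ∀ t ∈ Ico (-1 : ℝ) 0, ∀ x : EuclideanSpace ℝ (Fin 3),
      ‖u t x‖ ≤ C₀ / (‖x‖ + Real.sqrt (-t)))
    (_hU : ContDiff ℝ 2 U)
    (hans : ∀ t ∈ Ico (-1 : ℝ) 0, ∀ x : EuclideanSpace ℝ (Fin 3),
      u t x = pvAnsatz 0 (fun y _ => U y) t x) :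
    U = 0 :=
  pineauVicol2026_rss_liouville_alpha_zero C₀ u p U hsol hI hans

end Literature.Analysis.FluidPDE

end
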